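import Summits.QuantumFields.YangMills.Theorems.UnitScaleTiltProp7SymAvgTwBridge
import HarnessLib

/-!
# `UnitScaleTiltProp7SymAvgTwRightInverse` — THE SECOND BRIDGE OF RULING g26-№1 (2), item (3e): **`H^{tw} := H^{sym} + Γ ∘ r ∘ H^{sym}` IS AN EXACT RIGHT INVERSE OF PRINT'S `Q(U₀) = QTw U₀`**
# — from M12's right inverse `H^{sym}` of the symmetric linearised average (`Prop7HSym`, ✓ p603360∕p603952), the bridge `QTw = QSym − D_{Ū₀}∘r` (`Prop7SymAvgTwBridge.QTw_apply_eq`), and a linear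
# GAUGE LIFT `Γ` of coarse gauge parameters on which the twisted average is the coarse covariant derivative (`QTw(Γη) = D_{Ū₀}η`; intended `Γ = D_{U₀} ∘ ȟ`, `ȟ` the covariantly-constant
# extension along the combs — displayed); with the sup-norm row `‖H^{tw}X‖ ≤ (1 + C_Γ·C_r)·B_H·‖X‖` — the letter `H` of (45)–(46) ∕ `Chart47T3tw` ∕ (CH5EL-tw)
# (route `UnitScaleTilt`, crux K1 «MinimiserStabilityRegPr» stmt-QuantumFields-19200, stub `stub_existenceMinimalOrbit` (EX), route (α), (AVG-SYM)∕M12; def-free, count-neutral)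

Cell `ym3-torus` (HUMAN RULING D-0037, YM ladder rung R3 — YM₃ on T³ is a rung, not d = 4, not a mass gap, not Clay), width seat `ym-ust-20520-w5` (gen 3).

THE PRINT.  [Balaban1985Variational] p. 285: «H a linear operator … QH = I, RD*H = 0 (45) … |HB| ≦ B₀|B| (46)»; [Balaban1985BackgroundPropagators] Thm 3.12 (the operator `H(U)` with `Q(U)H(U) = I`), (3.14)
p. 393 (`Q(U)` = linear part of the double-bar average); [Balaban1985Averaging] p. 28 «A^λ_b = A_b − (D_{V₀}λ)(b)», (89)–(92) p. 31.

WHAT IS PROVED (sorry-free, no definition; hypotheses DISPLAYED by name — `hG`, `hr` as in `Prop7SymAvgTwBridge`; `hH : QSym U₀ (HX) = X` (M12); `hΓ : QTw U₀ (Γη)(c) = η(c₋) − Ū₀(c)η(c₊)Ū₀(c)⁻¹`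
(= (2) `QSym_gaugeDir` + `Prop7SymAvgTwFrameAxial.logChartTw_eq_logChartSym_of_inAx` on the axial slice, for `Γ = D_{U₀}∘ȟ` — junction not typed here); norm rows `‖HX‖ ≤ B_H‖X‖`, `‖Γη‖ ≤ C_Γ‖η‖`,
`‖r y A‖ ≤ C_r‖A‖`):
* §1 `pi_r_apply`, `norm_pi_r_le` (the frames bundled as one continuous linear map into coarse gauge parameters; sup bound).
* §2 ★★★**`QTw_rightInv_of_gaugeLift`** — `QTw U₀ (HX + Γ(y ↦ r y (HX))) = X` (three lines on `QTw_apply_eq`); ★★★**`exists_rightInv_QTw_of_gaugeLift`** — `∃ H′` ℂ-linear with `QTw U₀ ∘ H′ = id` and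
  `‖H′X‖ ≤ (1 + C_Γ·C_r)·B_H·‖X‖`.
HONEST FRAMING.  Linear algebra over the bridge; (45)-tw `R(U₀)D*H′ = 0` is NOT claimed (the G′(U₀) row of RULING g26-№1 (3)(5)); nothing of print is asserted.  `--supports stmt-QuantumFields-19200 --as helper`.

References: T. Bałaban, CMP 102 (1985) 277–309 [Balaban1985Variational] ((45)–(46) p.285, (47)–(49) p.285); CMP 99 (1985) 389–434 [Balaban1985BackgroundPropagators] (Thm 3.12, (3.14) p.393); CMP 98 (1985)
17–51 [Balaban1985Averaging] (p.28, (82) p.30, (89)–(92) p.31, (97) p.32, (161)–(162) p.42).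
-/

set_option autoImplicit false

noncomputable section

open scoped Matrix.Norms.L2Operator

namespace Summit.QuantumFields.YangMills.Theorems.Prop7SymAvgTwRightInverse

open NormedSpace
open Literature.MathematicalPhysics.QuantumFieldTheory.Balaban1983to89
open Literature.MathematicalPhysics.QuantumFieldTheory.Balaban1983to89.T3ContinuumYM3Torus
open T3SectALandauChart (bgUnits)
open B7Prop1Explicit (expUnit)
open Summit.QuantumFields.YangMills.Theorems.Prop7SymAvgGL (descendToGL QSym)
open Summit.QuantumFields.YangMills.Theorems.Prop7SymAvgTw (frameTw QTw)
open Summit.QuantumFields.YangMills.Theorems.Prop7SymAvgTwBridge (QTw_apply_eq)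

variable (F : T3Family) {n K : ℕ} (h : n ≤ K)

/-! ## §1 The linearised frames as ONE linear map into coarse gauge parameters -/

/-- The family `r y : E →L M₂` (one linearised frame per comparison site) bundled as a continuous linear map `A ↦ (y ↦ r y A)` into the coarse gauge-parameter fields.
[cite: Balaban1985Averaging, (82) p.30, (97) p.32] -/
theorem pi_r_apply (r : Site (F.P n) 0 → ((PBond (F.P K) 0 → (Matrix (Fin 2) (Fin 2) ℂ)) →L[ℂ] (Matrix (Fin 2) (Fin 2) ℂ))) (A : PBond (F.P K) 0 → (Matrix (Fin 2) (Fin 2) ℂ)) (y : Site (F.P n) 0) :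
    ContinuousLinearMap.pi r A y = r y A := rfl

/-- Sup-norm bound of the bundled frames: `‖r y A‖ ≤ C_r‖A‖` for every `y` ⟹ `‖(y ↦ r y A)‖ ≤ C_r‖A‖`. [cite: Balaban1985Averaging, (161)–(162) p.42] -/
theorem norm_pi_r_le (r : Site (F.P n) 0 → ((PBond (F.P K) 0 → (Matrix (Fin 2) (Fin 2) ℂ)) →L[ℂ] (Matrix (Fin 2) (Fin 2) ℂ))) {Cr : ℝ} (hCr : 0 ≤ Cr)
    (hr : ∀ y A, ‖r y A‖ ≤ Cr * ‖A‖) (A : PBond (F.P K) 0 → (Matrix (Fin 2) (Fin 2) ℂ)) :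
    ‖ContinuousLinearMap.pi r A‖ ≤ Cr * ‖A‖ :=
  (pi_norm_le_iff_of_nonneg (by positivity)).2 fun y => hr y A

/-! ## §2 THE TWISTED RIGHT INVERSE `H^{tw} := H^{sym} + Γ ∘ r ∘ H^{sym}` (RULING g26-№1 (2), item (3e)) -/

/-- ★★★ **`QTw ∘ H^{tw} = id` — THE BRIDGE FOR (46)**: let `H` be a right inverse of the symmetric linearised average (`QSym U₀ (HX) = X`, M12 ✓ `Prop7HSym`), let the bridge `QTw = QSym − D_{Ū₀}∘r` hold
(`Prop7SymAvgTwBridge.QTw_apply_eq` under its displayed differentiability hypotheses `hG`, `hr`), and let `Γ` be a linear GAUGE LIFT of coarse gauge parameters into fine fields on which the twisted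
average acts as the coarse covariant derivative — `QTw U₀ (Γη)(c) = η(c₋) − Ū₀(c)·η(c₊)·Ū₀(c)⁻¹` (the intended `Γη := D_{U₀}ȟ(η)`, `ȟ` = covariantly-constant extension along the combs: `QTw(D_{U₀}ȟη) =
QSym(D_{U₀}ȟη)` on the axial slice by `Prop7SymAvgTwFrameAxial.logChartTw_eq_logChartSym_of_inAx`, `= D_{Ū₀}(ȟ(η)↓) = D_{Ū₀}η` by the covariance of `descendTo` — DISPLAYED here as `hΓ`).  Then
**`H^{tw}X := HX + Γ(y ↦ r y (HX))`** is an EXACT right inverse of print's `Q(U₀) = QTw U₀`: `QTw(H^{tw}X) = X − D_{Ū₀}(r(HX)) + D_{Ū₀}(r(HX)) = X`.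
[cite: Balaban1985Variational, (45)–(46) p.285; Balaban1985BackgroundPropagators, (3.14) p.393, Thm 3.12; Balaban1985Averaging, p.28, (89) p.31] -/
theorem QTw_rightInv_of_gaugeLift (U₀ : GaugeField (F.P K) 0 (Matrix.specialUnitaryGroup (Fin 2) ℂ))
    {G' : (PBond (F.P K) 0 → (Matrix (Fin 2) (Fin 2) ℂ)) →L[ℂ] (PBond (F.P n) 0 → (Matrix (Fin 2) (Fin 2) ℂ))}
    (hG : HasFDerivAt (fun A : PBond (F.P K) 0 → (Matrix (Fin 2) (Fin 2) ℂ) => fun c : PBond (F.P n) 0 =>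
        ((descendToGL F n K h (fun b => expUnit (A b) * bgUnits F K U₀ b) c : (Matrix (Fin 2) (Fin 2) ℂ)ˣ) : (Matrix (Fin 2) (Fin 2) ℂ)) * (((descendToGL F n K h (bgUnits F K U₀) c)⁻¹ : (Matrix (Fin 2) (Fin 2) ℂ)ˣ) : (Matrix (Fin 2) (Fin 2) ℂ))) G' 0)
    {r : Site (F.P n) 0 → ((PBond (F.P K) 0 → (Matrix (Fin 2) (Fin 2) ℂ)) →L[ℂ] (Matrix (Fin 2) (Fin 2) ℂ))}
    (hr : ∀ y, HasFDerivAt (fun A : PBond (F.P K) 0 → (Matrix (Fin 2) (Fin 2) ℂ) => ((frameTw F n K h U₀ A y : (Matrix (Fin 2) (Fin 2) ℂ)ˣ) : (Matrix (Fin 2) (Fin 2) ℂ))) (r y) 0)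
    (H : (PBond (F.P n) 0 → (Matrix (Fin 2) (Fin 2) ℂ)) →ₗ[ℂ] (PBond (F.P K) 0 → (Matrix (Fin 2) (Fin 2) ℂ))) (hH : ∀ X, QSym F n K h U₀ (H X) = X)
    (Γ : (Site (F.P n) 0 → (Matrix (Fin 2) (Fin 2) ℂ)) →ₗ[ℂ] (PBond (F.P K) 0 → (Matrix (Fin 2) (Fin 2) ℂ)))
    (hΓ : ∀ (η : Site (F.P n) 0 → (Matrix (Fin 2) (Fin 2) ℂ)) (c : PBond (F.P n) 0),
      QTw F n K h U₀ (Γ η) c = η c.src - ((descendToGL F n K h (bgUnits F K U₀) c : (Matrix (Fin 2) (Fin 2) ℂ)ˣ) : (Matrix (Fin 2) (Fin 2) ℂ)) * η c.tgt * (((descendToGL F n K h (bgUnits F K U₀) c)⁻¹ : (Matrix (Fin 2) (Fin 2) ℂ)ˣ) : (Matrix (Fin 2) (Fin 2) ℂ)))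
    (X : PBond (F.P n) 0 → (Matrix (Fin 2) (Fin 2) ℂ)) :
    QTw F n K h U₀ (H X + Γ (fun y => r y (H X))) = X := by
  funext c
  rw [map_add, Pi.add_apply, QTw_apply_eq F h U₀ hG hr (H X) c, hH X, hΓ]
  have h0 : QTw F n K h U₀ (Γ fun y => (r y) (H X)) c
      = (fun y => (r y) (H X)) c.src - ((descendToGL F n K h (bgUnits F K U₀) c : (Matrix (Fin 2) (Fin 2) ℂ)ˣ) : (Matrix (Fin 2) (Fin 2) ℂ)) * (fun y => (r y) (H X)) c.tgt
          * (((descendToGL F n K h (bgUnits F K U₀) c)⁻¹ : (Matrix (Fin 2) (Fin 2) ℂ)ˣ) : (Matrix (Fin 2) (Fin 2) ℂ)) := hΓ _ c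
  simp only at h0 ⊢
  abel

/-- ★★★ **EXISTENCE OF THE TWISTED RIGHT INVERSE WITH ITS NORM** ((46)-tw from (46)-sym): under the hypotheses of `QTw_rightInv_of_gaugeLift` and the sup-norm rows `‖HX‖ ≤ B_H‖X‖` (M12), `‖Γη‖ ≤ C_Γ‖η‖`
(for `Γ = D_{U₀}∘ȟ`: `C_Γ = 2 + O(α₀)` — zero along the combs, a difference of two transports elsewhere), `‖r y A‖ ≤ C_r‖A‖` (the linearised frames; `C_r ≲ d·L^{K−n}`, RULING g26-№1 (3c)), there is a
ℂ-linear `H′` with **`QTw U₀ (H′X) = X`** and **`‖H′X‖ ≤ (1 + C_Γ·C_r)·B_H·‖X‖`** — the letter `H` of `Chart47T3tw` ∕ (CH5EL-tw).  (45)-tw `R(U₀)D*H′ = 0` is NOT claimed (separate G′(U₀) row).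
[cite: Balaban1985Variational, (45)–(46) p.285; Balaban1985BackgroundPropagators, Thm 3.12, (3.14) p.393] -/
theorem exists_rightInv_QTw_of_gaugeLift (U₀ : GaugeField (F.P K) 0 (Matrix.specialUnitaryGroup (Fin 2) ℂ))
    {G' : (PBond (F.P K) 0 → (Matrix (Fin 2) (Fin 2) ℂ)) →L[ℂ] (PBond (F.P n) 0 → (Matrix (Fin 2) (Fin 2) ℂ))}
    (hG : HasFDerivAt (fun A : PBond (F.P K) 0 → (Matrix (Fin 2) (Fin 2) ℂ) => fun c : PBond (F.P n) 0 =>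
        ((descendToGL F n K h (fun b => expUnit (A b) * bgUnits F K U₀ b) c : (Matrix (Fin 2) (Fin 2) ℂ)ˣ) : (Matrix (Fin 2) (Fin 2) ℂ)) * (((descendToGL F n K h (bgUnits F K U₀) c)⁻¹ : (Matrix (Fin 2) (Fin 2) ℂ)ˣ) : (Matrix (Fin 2) (Fin 2) ℂ))) G' 0)
    {r : Site (F.P n) 0 → ((PBond (F.P K) 0 → (Matrix (Fin 2) (Fin 2) ℂ)) →L[ℂ] (Matrix (Fin 2) (Fin 2) ℂ))}
    (hr : ∀ y, HasFDerivAt (fun A : PBond (F.P K) 0 → (Matrix (Fin 2) (Fin 2) ℂ) => ((frameTw F n K h U₀ A y : (Matrix (Fin 2) (Fin 2) ℂ)ˣ) : (Matrix (Fin 2) (Fin 2) ℂ))) (r y) 0)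
    {Cr : ℝ} (hCr : 0 ≤ Cr) (hrb : ∀ y A, ‖r y A‖ ≤ Cr * ‖A‖)
    (H : (PBond (F.P n) 0 → (Matrix (Fin 2) (Fin 2) ℂ)) →ₗ[ℂ] (PBond (F.P K) 0 → (Matrix (Fin 2) (Fin 2) ℂ))) (hH : ∀ X, QSym F n K h U₀ (H X) = X)
    {BH : ℝ} (hHb : ∀ X, ‖H X‖ ≤ BH * ‖X‖)
    (Γ : (Site (F.P n) 0 → (Matrix (Fin 2) (Fin 2) ℂ)) →ₗ[ℂ] (PBond (F.P K) 0 → (Matrix (Fin 2) (Fin 2) ℂ)))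
    (hΓ : ∀ (η : Site (F.P n) 0 → (Matrix (Fin 2) (Fin 2) ℂ)) (c : PBond (F.P n) 0),
      QTw F n K h U₀ (Γ η) c = η c.src - ((descendToGL F n K h (bgUnits F K U₀) c : (Matrix (Fin 2) (Fin 2) ℂ)ˣ) : (Matrix (Fin 2) (Fin 2) ℂ)) * η c.tgt * (((descendToGL F n K h (bgUnits F K U₀) c)⁻¹ : (Matrix (Fin 2) (Fin 2) ℂ)ˣ) : (Matrix (Fin 2) (Fin 2) ℂ)))
    {CΓ : ℝ} (hCΓ : 0 ≤ CΓ) (hΓb : ∀ η, ‖Γ η‖ ≤ CΓ * ‖η‖) :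
    ∃ H' : (PBond (F.P n) 0 → (Matrix (Fin 2) (Fin 2) ℂ)) →ₗ[ℂ] (PBond (F.P K) 0 → (Matrix (Fin 2) (Fin 2) ℂ)),
      (∀ X, QTw F n K h U₀ (H' X) = X) ∧ (∀ X, ‖H' X‖ ≤ (1 + CΓ * Cr) * BH * ‖X‖) := by
  refine ⟨H + Γ ∘ₗ ((ContinuousLinearMap.pi r : (PBond (F.P K) 0 → (Matrix (Fin 2) (Fin 2) ℂ)) →L[ℂ] (Site (F.P n) 0 → (Matrix (Fin 2) (Fin 2) ℂ))) : _ →ₗ[ℂ] _) ∘ₗ H,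
    fun X => ?_, fun X => ?_⟩
  · exact QTw_rightInv_of_gaugeLift F h U₀ hG hr H hH Γ hΓ X
  · have h1 : ‖H X‖ ≤ BH * ‖X‖ := hHb X
    have h2 : ‖Γ (ContinuousLinearMap.pi r (H X))‖ ≤ CΓ * (Cr * (BH * ‖X‖)) :=
      (hΓb _).trans (mul_le_mul_of_nonneg_left ((norm_pi_r_le F r hCr hrb (H X)).trans (mul_le_mul_of_nonneg_left h1 hCr)) hCΓ)
    calc ‖(H + Γ ∘ₗ ((ContinuousLinearMap.pi r : (PBond (F.P K) 0 → (Matrix (Fin 2) (Fin 2) ℂ)) →L[ℂ] (Site (F.P n) 0 → (Matrix (Fin 2) (Fin 2) ℂ))) : _ →ₗ[ℂ] _) ∘ₗ H) X‖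
        = ‖H X + Γ (ContinuousLinearMap.pi r (H X))‖ := by rfl
      _ ≤ ‖H X‖ + ‖Γ (ContinuousLinearMap.pi r (H X))‖ := norm_add_le _ _
      _ ≤ BH * ‖X‖ + CΓ * (Cr * (BH * ‖X‖)) := add_le_add h1 h2
      _ = (1 + CΓ * Cr) * BH * ‖X‖ := by ring

end Summit.QuantumFields.YangMills.Theorems.Prop7SymAvgTwRightInverse

end
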